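import Summits.Ventures.LatticeQCDFlow.Scoring.SU2TorusCharacterMoments
import Summits.Ventures.LatticeQCDFlow.Scoring.SU2TorusPlaquetteLimit
import HarnessLib

/-!
# SU(2) on the 2-torus: `⟨χ_j(U_p)⟩_{(ℤ/L)²,β} → (j+1) I_{j+1}(2β)/I₁(2β)`, exponentially fast in the volume

HONEST FRAMING: exact (Metropolis-corrected) sampling algorithms for lattice gauge theory;
figures of merit are autocorrelation/cost numbers at stated couplings and volumes; no
continuum-physics claim.

Venture `LatticeQCDFlow` (cell pub-lqcd), sub-topic `Scoring`; FANOUT row 5 (`s0-sun-a`), GEN-13.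
NEW WORK of the cell (placement rule), continuing `Scoring/SU2TorusCharacterMoments.lean`
(`⟨χ_j(U_{x₀})⟩ = N_j/Z`, `N_j = Σ_{i≤j} Σ_w c_{w+i} c_{w+j−i}^{L²−1}/(w+j−i+1)^{L²}`, `Z = Σ_n w_n^{L²}`,
`w_n = c_n/(n+1) = e^{−2β}I_{n+1}(2β)/β`):

* §1 abstract: for an antitone positive summable `w` and `V ≥ 2`, writing the numerator with
  `c_n = (n+1)w_n`, **`abs_div_tsum_charMoment_sub_le`**:
  `|N_j/Z − (j+1) w_j/w_0| ≤ (j+1)(j+2) (w_1/w_0)^{V−2} (Σ_n w_{n+1})/w_0` (the `(i, w) = (j, 0)` term is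
  `(j+1) w_j w_0^{V−1}`; every other term is at most `(j+1) w_0 w_n^{V−1}` with `n ≥ 1`);
* §2 **`abs_wilson_mean_chebyshevU_plaquette_two_sub_le`** — for `β > 0`, `L ≥ 2`, `j ∈ ℕ`:
  `|⟨χ_j(U_{x₀})⟩_{(ℤ/L)²,β} − (j+1) I_{j+1}(2β)/I₁(2β)| ≤ (j+1)(j+2)·(I₂(2β)/I₁(2β))^{L²−2}·Σ_n I_{n+2}(2β)/I₁(2β)`,
  and **`tendsto_wilson_mean_chebyshevU_plaquette_two`**: `⟨χ_j(U_{x₀})⟩_{(ℤ/(L+2))²,β} → (j+1) I_{j+1}(2β)/I₁(2β)`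
  (GEN-9's one-plaquette / Gross–Witten character expectation) as `L → ∞`.

Nothing is cited; no `def`.
-/

noncomputable section

open Real MeasureTheory Set Function Finset Filter Topology Polynomial.Chebyshev
open Literature.MathematicalPhysics.QuantumFieldTheory Literature.MathematicalPhysics.QuantumLattice
open Literature.Analysis.FunctionSpaces
open Summit.Ventures.LatticeQCDFlow.Exactness
open Summit.Ventures.LatticeQCDFlow.Theory2.Lattice

namespace Summit.Ventures.LatticeQCDFlow.Scoring

/-! ## §1. The abstract estimate -/

section Abstract

variable {w : ℕ → ℝ} (hanti : Antitone w) (hpos : ∀ n, 0 < w n) (hsum : Summable w)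
include hanti hpos hsum

/-- The shifted powers `w_{n+1}^{V−1}` are summable (`V ≥ 2`) and
`Σ_n w_{n+1}^{V−1} ≤ w_1^{V−2} Σ_n w_{n+1}`. -/
theorem tsum_pow_succ_le (V : ℕ) (hV : 2 ≤ V) :
    Summable (fun n => w (n + 1) ^ (V - 1)) ∧
      ∑' n, w (n + 1) ^ (V - 1) ≤ w 1 ^ (V - 2) * ∑' n, w (n + 1) := by
  obtain ⟨V', rfl⟩ : ∃ V', V = V' + 2 := ⟨V - 2, by omega⟩
  simp only [show V' + 2 - 1 = V' + 1 from rfl, show V' + 2 - 2 = V' from rfl]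
  have hs1 : Summable fun n => w (n + 1) := (summable_nat_add_iff 1).mpr hsum
  have hle : ∀ n, w (n + 1) ^ (V' + 1) ≤ w 1 ^ V' * w (n + 1) := fun n => by
    rw [pow_succ]
    exact mul_le_mul_of_nonneg_right
      (pow_le_pow_left₀ (hpos _).le (hanti (by omega : 1 ≤ n + 1)) V') (hpos _).le
  have hs : Summable fun n => w (n + 1) ^ (V' + 1) :=
    Summable.of_nonneg_of_le (fun n => pow_nonneg (hpos _).le _) hle (hs1.mul_left _)
  refine ⟨hs, ?_⟩
  rw [← tsum_mul_left]
  exact hs.tsum_le_tsum hle (hs1.mul_left _)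

/-- **The general character moment: exponentially small finite-volume correction.**  For an
antitone positive summable `w`, `V ≥ 2` and `j ∈ ℕ`, with `c_n = (n+1) w_n`:
`|Σ_{i≤j} Σ_m c_{m+i} c_{m+j−i}^{V−1}/(m+j−i+1)^V / Σ_n w_n^V − (j+1) w_j/w_0|
 ≤ (j+1)(j+2) (w_1/w_0)^{V−2} (Σ_n w_{n+1})/w_0`. -/
theorem abs_div_tsum_charMoment_sub_le (V : ℕ) (hV : 2 ≤ V) (j : ℕ) :
    |(∑ i ∈ Finset.range (j + 1), ∑' m : ℕ,
        ((((m + i : ℕ) : ℝ) + 1) * w (m + i)) *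
          ((((m + (j - i) : ℕ) : ℝ) + 1) * w (m + (j - i))) ^ (V - 1) *
          ((((m + (j - i) : ℕ) : ℝ) + 1) ^ V)⁻¹) / (∑' n, w n ^ V) -
      ((j : ℝ) + 1) * w j / w 0| ≤
      ((j : ℝ) + 1) * ((j : ℝ) + 2) * (w 1 / w 0) ^ (V - 2) * (∑' n, w (n + 1)) / w 0 := by
  obtain ⟨V', rfl⟩ : ∃ V', V = V' + 2 := ⟨V - 2, by omega⟩
  simp only [show V' + 2 - 1 = V' + 1 from rfl, show V' + 2 - 2 = V' from rfl]
  have hw0 := hpos 0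
  -- the summand, simplified: `c_{m+i} c_n^{V−1}/(n+1)^V = (m+i+1) w_{m+i} w_n^{V−1}/(n+1)`
  set T : ℕ → ℕ → ℝ := fun i m => ((((m + i : ℕ) : ℝ) + 1) * w (m + i)) *
    ((((m + (j - i) : ℕ) : ℝ) + 1) * w (m + (j - i))) ^ (V' + 1) *
    ((((m + (j - i) : ℕ) : ℝ) + 1) ^ (V' + 2))⁻¹ with hT
  have hTeq : ∀ i m, T i m = (((m + i : ℕ) : ℝ) + 1) / (((m + (j - i) : ℕ) : ℝ) + 1) *
      (w (m + i) * w (m + (j - i)) ^ (V' + 1)) := fun i m => by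
    simp only [hT]
    rw [mul_pow, pow_succ (((m + (j - i) : ℕ) : ℝ) + 1) (V' + 1)]
    have : (((m + (j - i) : ℕ) : ℝ) + 1) ≠ 0 := by positivity
    have : (((m + (j - i) : ℕ) : ℝ) + 1) ^ (V' + 1) ≠ 0 := by positivity
    field_simp
  have hT0 : ∀ i m, 0 ≤ T i m := fun i m => by
    rw [hTeq]; have := hpos (m + i); have := hpos (m + (j - i)); positivity
  -- `R = Σ_n w_{n+1}^{V−1}`
  obtain ⟨hRs, hRle⟩ := tsum_pow_succ_le hanti hpos hsum (V' + 2) (by omega)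
  simp only [show V' + 2 - 1 = V' + 1 from rfl, show V' + 2 - 2 = V' from rfl] at hRs hRle
  set R := ∑' n, w (n + 1) ^ (V' + 1) with hR
  have hR0 : 0 ≤ R := tsum_nonneg fun n => pow_nonneg (hpos _).le _
  -- termwise bound for `i < j`: `T i m ≤ (j+1) w_0 w_{m+1}^{V−1}`
  have hratio : ∀ i m, i ≤ j → (((m + i : ℕ) : ℝ) + 1) / (((m + (j - i) : ℕ) : ℝ) + 1) ≤ (j : ℝ) + 1 :=
    fun i m hij => by
    rw [div_le_iff₀ (by positivity)]
    have h1 : ((m + i : ℕ) : ℝ) + 1 ≤ ((m : ℝ) + j + 1) := by push_cast; linarith [show (i:ℝ) ≤ j by exact_mod_cast hij]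
    have h2 : (1 : ℝ) ≤ ((m + (j - i) : ℕ) : ℝ) + 1 := by
      have : (0 : ℝ) ≤ ((m + (j - i) : ℕ) : ℝ) := by positivity
      linarith
    have h3 : ((m : ℝ) + j + 1) ≤ ((j : ℝ) + 1) * (((m + (j - i) : ℕ) : ℝ) + 1) := by
      have hm : (m : ℝ) ≤ ((m + (j - i) : ℕ) : ℝ) := by exact_mod_cast Nat.le_add_right m (j - i)
      nlinarith [show (0:ℝ) ≤ j by positivity]
    linarith
  have hTle_lt : ∀ i m, i < j → T i m ≤ ((j : ℝ) + 1) * w 0 * w (m + 1) ^ (V' + 1) := fun i m hij => by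
    rw [hTeq]
    have h1 := hratio i m hij.le
    have h2 : w (m + i) ≤ w 0 := hanti (Nat.zero_le _)
    have h3 : w (m + (j - i)) ^ (V' + 1) ≤ w (m + 1) ^ (V' + 1) :=
      pow_le_pow_left₀ (hpos _).le (hanti (by omega)) _
    have := hpos (m + i); have := hpos (m + (j - i)); have := hpos (m + 1)
    calc (((m + i : ℕ) : ℝ) + 1) / (((m + (j - i) : ℕ) : ℝ) + 1) * (w (m + i) * w (m + (j - i)) ^ (V' + 1))
        ≤ ((j : ℝ) + 1) * (w 0 * w (m + 1) ^ (V' + 1)) :=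
          mul_le_mul h1 (mul_le_mul h2 h3 (by positivity) hw0.le) (by positivity) (by positivity)
      _ = _ := by ring
  -- termwise bound for `i = j`, `m ≥ 1`
  have hTle_eq : ∀ m, T j (m + 1) ≤ ((j : ℝ) + 1) * w 0 * w (m + 1) ^ (V' + 1) := fun m => by
    rw [hTeq]
    have h1 := hratio j (m + 1) le_rfl
    have h2 : w (m + 1 + j) ≤ w 0 := hanti (Nat.zero_le _)
    simp only [Nat.sub_self, add_zero] at h1 ⊢
    have := hpos (m + 1 + j); have := hpos (m + 1)
    calc (((m + 1 + j : ℕ) : ℝ) + 1) / (((m + 1 : ℕ) : ℝ) + 1) * (w (m + 1 + j) * w (m + 1) ^ (V' + 1))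
        ≤ ((j : ℝ) + 1) * (w 0 * w (m + 1) ^ (V' + 1)) :=
          mul_le_mul h1 (mul_le_mul_of_nonneg_right h2 (by positivity)) (by positivity) (by positivity)
      _ = _ := by ring
  -- the leading term
  have hTj0 : T j 0 = ((j : ℝ) + 1) * w j * w 0 ^ (V' + 1) := by
    rw [hTeq]
    simp only [Nat.sub_self, add_zero, zero_add, Nat.cast_zero]
    rw [div_one]
    ring
  -- summability of each family and the bounds on the inner sums
  have hbd : Summable fun m => ((j : ℝ) + 1) * w 0 * w (m + 1) ^ (V' + 1) := hRs.mul_left _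
  have hTs_lt : ∀ i, i < j → Summable (T i) := fun i hij =>
    Summable.of_nonneg_of_le (hT0 i) (fun m => hTle_lt i m hij) hbd
  have hTs_eq' : Summable fun m => T j (m + 1) :=
    Summable.of_nonneg_of_le (fun m => hT0 j _) hTle_eq hbd
  have hTs_eq : Summable (T j) := (summable_nat_add_iff 1).mp hTs_eq'
  have hin_lt : ∀ i, i < j → ∑' m, T i m ≤ ((j : ℝ) + 1) * w 0 * R := fun i hij => by
    rw [hR, ← tsum_mul_left]
    exact (hTs_lt i hij).tsum_le_tsum (fun m => hTle_lt i m hij) hbd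
  have hin_eq : ∑' m, T j m ≤ ((j : ℝ) + 1) * w j * w 0 ^ (V' + 1) + ((j : ℝ) + 1) * w 0 * R := by
    rw [hTs_eq.tsum_eq_zero_add, hTj0, hR, ← tsum_mul_left]
    exact add_le_add le_rfl (hTs_eq'.tsum_le_tsum hTle_eq hbd)
  have hin_eq_ge : ((j : ℝ) + 1) * w j * w 0 ^ (V' + 1) ≤ ∑' m, T j m := by
    rw [hTs_eq.tsum_eq_zero_add, hTj0]
    exact le_add_of_nonneg_right (tsum_nonneg fun m => hT0 j _)
  -- the numerator `N = Σ_{i<j} (inner i) + inner j`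
  have hsplit : ∑ i ∈ Finset.range (j + 1), ∑' m, T i m =
      ∑ i ∈ Finset.range j, ∑' m, T i m + ∑' m, T j m := Finset.sum_range_succ _ j
  have hNlo : ((j : ℝ) + 1) * w j * w 0 ^ (V' + 1) ≤ ∑ i ∈ Finset.range (j + 1), ∑' m, T i m := by
    rw [hsplit]
    exact le_add_of_nonneg_of_le (Finset.sum_nonneg fun i _ => tsum_nonneg (hT0 i)) hin_eq_ge
  have hNhi : ∑ i ∈ Finset.range (j + 1), ∑' m, T i m ≤
      ((j : ℝ) + 1) * w j * w 0 ^ (V' + 1) + ((j : ℝ) + 1) * ((j : ℝ) + 1) * w 0 * R := by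
    rw [hsplit]
    have h1 : ∑ i ∈ Finset.range j, ∑' m, T i m ≤ ∑ i ∈ Finset.range j, ((j : ℝ) + 1) * w 0 * R :=
      Finset.sum_le_sum fun i hi => hin_lt i (Finset.mem_range.mp hi)
    rw [Finset.sum_const, Finset.card_range, nsmul_eq_mul] at h1
    nlinarith [h1, hin_eq, hR0, hw0]
  -- the partition function `Z = w_0^V + Σ_{n≥1} w_n^V`, `0 ≤ Z − w_0^V ≤ w_0 R`
  have hZs : Summable fun n => w n ^ (V' + 2) := summable_pow_of_antitone hanti hpos hsum _ (by omega)
  have hZsplit := hZs.tsum_eq_zero_add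
  have hZtail0 : 0 ≤ ∑' n, w (n + 1) ^ (V' + 2) := tsum_nonneg fun n => pow_nonneg (hpos _).le _
  have hZtail : ∑' n, w (n + 1) ^ (V' + 2) ≤ w 0 * R := by
    rw [hR, ← tsum_mul_left]
    refine ((summable_nat_add_iff 1).mpr hZs).tsum_le_tsum (fun n => ?_) (hRs.mul_left _)
    rw [pow_succ, mul_comm]
    exact mul_le_mul_of_nonneg_right (hanti (Nat.zero_le _)) (pow_nonneg (hpos _).le _)
  have hZpos : 0 < ∑' n, w n ^ (V' + 2) := by
    rw [hZsplit]; exact add_pos_of_pos_of_nonneg (pow_pos hw0 _) hZtail0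
  -- assemble: `N/Z − (j+1)w_j/w_0 = (N w_0 − (j+1) w_j Z)/(w_0 Z)`
  set N := ∑ i ∈ Finset.range (j + 1), ∑' m, T i m with hN
  set Z := ∑' n, w n ^ (V' + 2) with hZ
  have hwj : w j ≤ w 0 := hanti (Nat.zero_le _)
  have hwj0 := hpos j
  have hkey : |N / Z - ((j : ℝ) + 1) * w j / w 0| ≤ ((j : ℝ) + 1) * ((j : ℝ) + 2) * R / w 0 ^ (V' + 1) := by
    rw [div_sub_div _ _ hZpos.ne' hw0.ne', abs_div, abs_of_pos (mul_pos hZpos hw0),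
      div_le_div_iff₀ (mul_pos hZpos hw0) (pow_pos hw0 _)]
    have hZge : w 0 ^ (V' + 2) ≤ Z := by rw [hZsplit]; exact le_add_of_nonneg_right hZtail0
    have hZle : Z ≤ w 0 ^ (V' + 2) + w 0 * R := by rw [hZsplit]; linarith
    have hjw : 0 ≤ ((j : ℝ) + 1) * w j := by positivity
    -- `|N w_0 − (j+1) w_j Z| ≤ (j+1)² w_0² R + (j+1) w_j w_0 R`
    have hnum : |N * w 0 - Z * (((j : ℝ) + 1) * w j)| ≤
        (((j : ℝ) + 1) * ((j : ℝ) + 1) * w 0 * R) * w 0 + ((j : ℝ) + 1) * w j * (w 0 * R) := by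
      have a1 : ((j : ℝ) + 1) * w j * w 0 ^ (V' + 1) * w 0 ≤ N * w 0 :=
        mul_le_mul_of_nonneg_right hNlo hw0.le
      have a2 : Z * (((j : ℝ) + 1) * w j) ≤ (w 0 ^ (V' + 2) + w 0 * R) * (((j : ℝ) + 1) * w j) :=
        mul_le_mul_of_nonneg_right hZle hjw
      have a3 : N * w 0 ≤ (((j : ℝ) + 1) * w j * w 0 ^ (V' + 1) +
          ((j : ℝ) + 1) * ((j : ℝ) + 1) * w 0 * R) * w 0 := mul_le_mul_of_nonneg_right hNhi hw0.le
      have a4 : w 0 ^ (V' + 2) * (((j : ℝ) + 1) * w j) ≤ Z * (((j : ℝ) + 1) * w j) :=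
        mul_le_mul_of_nonneg_right hZge hjw
      have a5 : 0 ≤ ((j : ℝ) + 1) * ((j : ℝ) + 1) * w 0 * R * w 0 := by
        have := mul_nonneg hw0.le hR0; positivity
      have a6 : 0 ≤ ((j : ℝ) + 1) * w j * (w 0 * R) := mul_nonneg hjw (mul_nonneg hw0.le hR0)
      have e1 : w 0 ^ (V' + 1) * w 0 = w 0 ^ (V' + 2) := by ring
      rw [abs_le]
      constructor
      · nlinarith [a1, a2, a5, e1]
      · nlinarith [a3, a4, a6, e1]
    have hstep : (((j : ℝ) + 1) * ((j : ℝ) + 1) * w 0 * R) * w 0 + ((j : ℝ) + 1) * w j * (w 0 * R) ≤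
        (((j : ℝ) + 1) * ((j : ℝ) + 1) * w 0 * R) * w 0 + ((j : ℝ) + 1) * w 0 * (w 0 * R) := by
      have : ((j : ℝ) + 1) * w j * (w 0 * R) ≤ ((j : ℝ) + 1) * w 0 * (w 0 * R) :=
        mul_le_mul_of_nonneg_right (mul_le_mul_of_nonneg_left hwj (by positivity))
          (mul_nonneg hw0.le hR0)
      linarith
    calc |N * w 0 - Z * (((j : ℝ) + 1) * w j)| * w 0 ^ (V' + 1)
        ≤ ((((j : ℝ) + 1) * ((j : ℝ) + 1) * w 0 * R) * w 0 + ((j : ℝ) + 1) * w j * (w 0 * R)) *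
            w 0 ^ (V' + 1) := mul_le_mul_of_nonneg_right hnum (by positivity)
      _ ≤ ((((j : ℝ) + 1) * ((j : ℝ) + 1) * w 0 * R) * w 0 + ((j : ℝ) + 1) * w 0 * (w 0 * R)) *
            w 0 ^ (V' + 1) := mul_le_mul_of_nonneg_right hstep (by positivity)
      _ = ((j : ℝ) + 1) * ((j : ℝ) + 2) * R * (w 0 ^ (V' + 2) * w 0) := by ring
      _ ≤ ((j : ℝ) + 1) * ((j : ℝ) + 2) * R * (Z * w 0) :=
          mul_le_mul_of_nonneg_left (mul_le_mul_of_nonneg_right hZge hw0.le)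
            (mul_nonneg (by positivity) hR0)
  refine hkey.trans ?_
  -- `R/w_0^{V−1} ≤ (w_1/w_0)^{V−2} (Σ w_{n+1})/w_0`
  rw [div_le_div_iff₀ (pow_pos hw0 _) hw0]
  have hS0 : 0 ≤ ∑' n, w (n + 1) := tsum_nonneg fun n => (hpos _).le
  calc ((j : ℝ) + 1) * ((j : ℝ) + 2) * R * w 0
      ≤ ((j : ℝ) + 1) * ((j : ℝ) + 2) * (w 1 ^ V' * ∑' n, w (n + 1)) * w 0 :=
        mul_le_mul_of_nonneg_right (mul_le_mul_of_nonneg_left hRle (by positivity)) hw0.le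
    _ = ((j : ℝ) + 1) * ((j : ℝ) + 2) * (w 1 / w 0) ^ V' * (∑' n, w (n + 1)) * (w 0 ^ V' * w 0) := by
        rw [div_pow]; field_simp
    _ = ((j : ℝ) + 1) * ((j : ℝ) + 2) * (w 1 / w 0) ^ V' * (∑' n, w (n + 1)) * w 0 ^ (V' + 1) := by
        ring

end Abstract

/-! ## §2. The SU(2) torus: general character moments, finite-volume law and limit -/

/-- **EXPONENTIALLY SMALL FINITE-VOLUME CORRECTION OF EVERY CHARACTER MOMENT.**  For `β > 0`, `L ≥ 2`,
`j ∈ ℕ` and every plaquette `x₀` of `(ℤ/L)²`, under theory-2's Wilson measure: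
`|⟨χ_j(U_{x₀})⟩ − (j+1) I_{j+1}(2β)/I₁(2β)| ≤ (j+1)(j+2)·(I₂(2β)/I₁(2β))^{L²−2}·Σ_n I_{n+2}(2β)/I₁(2β)`
(`(j+1) I_{j+1}(2β)/I₁(2β) = c_j/c_0`, GEN-9's one-plaquette character expectation). -/
theorem abs_wilson_mean_chebyshevU_plaquette_two_sub_le {L : ℕ} [NeZero L] {β : ℝ} (hβ : 0 < β)
    (hL : 2 ≤ L) (x₀ : Site 2 L) (j : ℕ) :
    |∫ V, (U ℝ j).eval (su2a0 (plaquetteHolonomy V x₀ 0 1))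
        ∂(wilsonMeasure (d := 2) (L := L) (fundamentalRep (Fin 2)) β) -
        ((j : ℝ) + 1) * besselI (j + 1) (2 * β) / besselI 1 (2 * β)| ≤
      ((j : ℝ) + 1) * ((j : ℝ) + 2) * (besselI 2 (2 * β) / besselI 1 (2 * β)) ^ (L ^ 2 - 2) *
        (∑' n : ℕ, besselI (n + 2) (2 * β)) / besselI 1 (2 * β) := by
  set w : ℕ → ℝ := fun n => Real.exp (-(2 * β)) * (besselI n (2 * β) - besselI (n + 2) (2 * β)) /
    ((n : ℝ) + 1) with hw
  have hanti : Antitone w := charCoeff_div_succ_antitone hβ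
  have hpos : ∀ n, 0 < w n := charCoeff_div_succ_pos hβ
  have hsum : Summable w := summable_charCoeff_div_succ hβ.le
  have hV : 2 ≤ L ^ 2 := by nlinarith
  have habs := abs_div_tsum_charMoment_sub_le hanti hpos hsum (L ^ 2) hV j
  have hw' : ∀ n, w n = Real.exp (-(2 * β)) * besselI (n + 1) (2 * β) / β := fun n =>
    charCoeff_div_succ_eq_besselI n hβ.ne'
  have hc : ∀ n : ℕ, Real.exp (-(2 * β)) * (besselI n (2 * β) - besselI (n + 2) (2 * β)) =
      ((n : ℝ) + 1) * w n := by
    intro n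
    rw [hw]
    simp only
    field_simp
  have hI1 : 0 < besselI 1 (2 * β) := besselI_pos 1 (by linarith)
  have he : 0 < Real.exp (-(2 * β)) := Real.exp_pos _
  have hratio : w 1 / w 0 = besselI 2 (2 * β) / besselI 1 (2 * β) := by
    rw [hw' 1, hw' 0]
    field_simp
  have hlead : ((j : ℝ) + 1) * w j / w 0 = ((j : ℝ) + 1) * besselI (j + 1) (2 * β) / besselI 1 (2 * β) := by
    rw [hw' j, hw' 0]
    field_simp
  have hS : ((j : ℝ) + 1) * ((j : ℝ) + 2) * (w 1 / w 0) ^ (L ^ 2 - 2) * (∑' n : ℕ, w (n + 1)) / w 0 =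
      ((j : ℝ) + 1) * ((j : ℝ) + 2) * (besselI 2 (2 * β) / besselI 1 (2 * β)) ^ (L ^ 2 - 2) *
        (∑' n : ℕ, besselI (n + 2) (2 * β)) / besselI 1 (2 * β) := by
    have h1 : (fun n : ℕ => w (n + 1)) = fun n => (Real.exp (-(2 * β)) / β) * besselI (n + 2) (2 * β) := by
      funext n; rw [hw' (n + 1)]; ring
    rw [hratio, h1, tsum_mul_left, hw' 0]
    field_simp
  have hnum : ∀ (i m : ℕ),
      (Real.exp (-(2 * β)) * (besselI (m + i) (2 * β) - besselI (m + i + 2) (2 * β))) *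
        (Real.exp (-(2 * β)) * (besselI (m + (j - i)) (2 * β) - besselI (m + (j - i) + 2) (2 * β))) ^
          (L ^ 2 - 1) *
        ((((m + (j - i) : ℕ) : ℝ) + 1) ^ (L ^ 2))⁻¹ =
      ((((m + i : ℕ) : ℝ) + 1) * w (m + i)) *
        ((((m + (j - i) : ℕ) : ℝ) + 1) * w (m + (j - i))) ^ (L ^ 2 - 1) *
        ((((m + (j - i) : ℕ) : ℝ) + 1) ^ (L ^ 2))⁻¹ := by
    intro i m
    rw [hc (m + i), hc (m + (j - i))]
  have hden : ∀ n : ℕ, (Real.exp (-(2 * β)) * (besselI n (2 * β) - besselI (n + 2) (2 * β)) /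
      ((n : ℝ) + 1)) ^ (L ^ 2) = w n ^ (L ^ 2) := fun n => rfl
  rw [wilson_mean_chebyshevU_plaquette_two hβ.le x₀ j]
  simp_rw [hnum, hden]
  rw [← hlead, ← hS]
  exact habs

/-- **THE THERMODYNAMIC LIMIT OF EVERY CHARACTER MOMENT.**  For `β > 0` and `j ∈ ℕ`,
`⟨χ_j(U_p)⟩_{(ℤ/(L+2))²,β} → (j+1) I_{j+1}(2β)/I₁(2β)` as `L → ∞` (plaquette at the origin). -/
theorem tendsto_wilson_mean_chebyshevU_plaquette_two {β : ℝ} (hβ : 0 < β) (j : ℕ) :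
    Tendsto (fun L : ℕ => ∫ V, (U ℝ j).eval (su2a0 (plaquetteHolonomy V (0 : Site 2 (L + 2)) 0 1))
        ∂(wilsonMeasure (d := 2) (L := L + 2) (fundamentalRep (Fin 2)) β))
      atTop (𝓝 (((j : ℝ) + 1) * besselI (j + 1) (2 * β) / besselI 1 (2 * β))) := by
  obtain ⟨hr0, hr1⟩ := besselI_two_div_one_lt_one hβ
  set r : ℝ := besselI 2 (2 * β) / besselI 1 (2 * β) with hr
  set K : ℝ := (∑' n : ℕ, besselI (n + 2) (2 * β)) / besselI 1 (2 * β) with hK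
  have hexp : Tendsto (fun L : ℕ => (L + 2) ^ 2 - 2) atTop atTop := by
    refine tendsto_atTop_mono (fun L => ?_) tendsto_id
    have : (L + 2) ^ 2 = L * L + 4 * L + 4 := by ring
    simp only [id_eq]
    omega
  have hpow : Tendsto (fun L : ℕ => r ^ ((L + 2) ^ 2 - 2)) atTop (𝓝 0) :=
    (tendsto_pow_atTop_nhds_zero_of_lt_one hr0 hr1).comp hexp
  have hbound : Tendsto (fun L : ℕ => ((j : ℝ) + 1) * ((j : ℝ) + 2) * r ^ ((L + 2) ^ 2 - 2) * K)
      atTop (𝓝 0) := by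
    simpa using (hpow.const_mul (((j : ℝ) + 1) * ((j : ℝ) + 2))).mul_const K
  rw [tendsto_iff_norm_sub_tendsto_zero]
  refine squeeze_zero (fun L => norm_nonneg _) (fun L => ?_) hbound
  rw [Real.norm_eq_abs, hK, ← mul_div_assoc]
  exact abs_wilson_mean_chebyshevU_plaquette_two_sub_le (L := L + 2) hβ (by omega) 0 j

end Summit.Ventures.LatticeQCDFlow.Scoring
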